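import Literature.AlgebraicGeometry.GroupSchemes.FrobeniusKernelUnitComponent          -- ★ (FKw-ord): `Ker F^t` through the unit component, layer criterion
import Literature.AlgebraicGeometry.GroupSchemes.EtaleOfCotangentRankZero              -- ★ `exists_augmentation_ker_eq` (+ unit component, cotangent of `G⁰`, PRODUCER)
import Literature.AlgebraicGeometry.GroupSchemes.BarsottiTateGroupFixedPartCotangent   -- ★ `comap_ker_unit_eq`, `ker_unit_le_comap` (unit-cotangent functoriality)
import Literature.AlgebraicGeometry.AbelianSchemes.FrobeniusKernelLawBlockAssembly     -- ★ `comp_mulN_eq_one_of_comp_relFrobeniusOver_eq_one`, «killed by an ideal» calculus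
import HarnessLib

/-!
# The Frobenius kernel of the `𝔭^n`-torsion of an abelian variety with `𝒪`-action lies in the `𝔭`-torsion
# (`𝔭` unramified over `p`, the unit component of `A[𝔭]` monogenic of exponent `≥ f`)

Topic `Literature/AlgebraicGeometry/GroupSchemes`; namespaces `Literature.AlgebraicGeometry.GroupSchemes` (§1–§2, finite group schemes over a
field) and `Literature.AlgebraicGeometry.AbelianSchemes.AbelianSchemeOver` (§3, the head).  THEOREMS ONLY (no definition, no named fact, no
instance, no notation, no `sorry`).  Cell `hodgecm-mathlib` (D-0151), FLOOR 0, P6 «MOD programme» (crux hLiu418 = stmt-HodgeConjecture-24832,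
`--supports`, count-neutral): organ **(hsat) «FROBENIUS SATURATION OF THE `c•w` BLOCK»** of line L3 (socket `stub_FROB` ▸ `stub_ROOF0`, road (γ),
LA3-plan (g2) 2026-09-02T06:34:27Z ∕ 06:37:01Z; consumer (R3) `F0P6aRoofCwKernel.hlaw_cw_of_dockClauses`, binder `hsat`):
«`A[F_q] ∩ A[𝔭^n] ⊆ A[𝔭]`» at a special point, read off the DOCK rows `hkerG₀`, `hU₀`, `θU₀`, `hNU₀` and the unramifiedness of `𝔭` — with NO
Barsotti–Tate group, NO block idempotent and NO height ∕ signature socket.  HC_CM is proved only modulo the printed citations until rung 0 closes;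
this file is generic and changes no count.

THE PRINT.  For a `p`-divisible group `𝒢` of dimension one over a perfect field the connected part has layers `k[X]⧸(X^{p^{nh}})`
([Tate1967] §2.2, proof of Prop. 1; [Messing1972] II (3.3.18)), `Ker F^t = V(X^{p^t})` ([Demazure1972] II §7; [SGA3I] VII_A 4.1–4.3) and the
closed subschemes of a layer are nested by rank ([AtiyahMacdonald1969] Prop. 8.8); hence `Ker F^f ∩ 𝒢 ⊆ 𝒢[p]` as soon as the height of `𝒢⁰`
is `≥ f`.  [Liu2021] p. 137 uses this for the `c•w`-block `E_∞|_T` («of dimension 1 and `O_𝔭`-height 2») of the reduction of the CM abelian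
variety: a `q`-torsion point killed by `F_q` and by a power of `𝔭_{c•w}` is killed by `𝔭_{c•w}`.  The finite-level form proved here replaces
«`Lie 𝒢 = T_e 𝒢[p]`» by «`Ker F_p ⊆ A[p]`» ([MumfordAV1970] §15, `[p] = V ∘ F`) and reads «dimension one» as «the unit component of `A[𝔭]` is
`Spec k[X]⧸(X^{p^N})`» ([Tate1997FiniteFlatGroupSchemes] (3.7)); unramifiedness enters once, as `𝔭 ≤ 𝔭² + (p)`.

THE ROUTE (tree vocabulary: ★ `relFrobeniusOver p t G : G ⟶ frobeniusTwistOver p t G`, ★ `GroupSchemeKernel.ker ∕ kerι ∕ kerLift`, ★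
`AffineGroupScheme.Alg`, Mathlib `Ideal.Cotangent ∕ Ideal.mapCotangent`).
§1 For ANY affine `k`-group scheme `G`: the ideal of `Ker F^t ↪ G` lies in the span of the `p^t`-th powers of the augmentation ideal `I_e`
(`(π a + m)^{p^t} = (π a)^{p^t} + m^{p^t}`, the «⊆» half of ★ (FKw) `ker_appTop_kerι_relFrobeniusOver_eq_span` without a principal generator), hence in
`I_e²` when `p^t ≥ 2`; so `Γ(G) ↠ Γ(Ker F^t)` induces a BIJECTION of unit cotangent spaces (★ `Ideal.mapCotangent_bijective_of_surjective_of_ker_le_sq`):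
`dim cot(G) = dim cot(Ker F^t)`.  A homomorphic closed immersion `X ↪ Y` gives `dim cot(X) ≤ dim cot(Y)`.
§2 A monogenic `k`-group `Γ(U₀) ≃ₐ k[X]⧸(X^N)` has `dim cot(U₀) ≤ 1` (Mathlib `finrank_cotangentSpace_le_one_iff`).
§3 HEAD.  `H = A[𝔭^n] ↪ A` (any closed subgroup with the kernel-of-`𝔭^n` clause), `U = H⁰` (★ `exists_unitComponent`): `cot(U) = cot(H)` (★
`finrank_cotangent_ker_unit_eq_of_unitComponent`) `= cot(Ker F_p|_H)` (§1); `Ker F_p|_H ↪ A` is `p`-torsion (★ `comp_mulN_eq_one_of_comp_relFrobeniusOver_eq_one`)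
and `𝔭^n`-torsion, so killed by `𝔭^n + (p) ⊇ 𝔭` (UNRAMIFIED), so it is a homomorphic closed subscheme of `G₀ = A[𝔭]` and — one point — of `U₀ = G₀⁰`:
`dim cot(U) ≤ dim cot(U₀) ≤ 1` (§2).  So `Γ(U) ≃ k[X]⧸(X^M)` (★ PRODUCER `exists_algEquiv_quotient_X_pow_of_connectedSpace`), closed subschemes of `U` are
nested by rank (★ `exists_fac_of_finrank_alg_le`), and `Ker F_f|_U` (rank `min(p^f, M) ≤ p^f`, ★ `finrank_alg_ker_relFrobeniusOver`) lies in `U₀`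
(rank `p^{N}`, `f ≤ N`) `⊆ G₀`.  A point `x` of `A` killed by `𝔭^n` and by `F_f` lies in `Ker F_f|_H ≅ Ker F_f|_U` (★
`exists_iso_ker_relFrobeniusOver_unitComponent`), hence in `G₀`: `x` is killed by `𝔭`.

## References
* [Tate1967] J. T. Tate, *p-divisible groups*, Proc. Conf. Local Fields (Driebergen, 1966), Springer (1967) — §2.2, proof of Prop. 1.
* [Messing1972] W. Messing, *The Crystals Associated to Barsotti–Tate Groups*, LNM 264 (1972) — Ch. II (3.3.18).
* [Demazure1972] M. Demazure, *Lectures on p-divisible groups*, LNM 302 (1972) — Ch. II §7.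
* [SGA3I] M. Demazure, A. Grothendieck (eds.), *SGA 3, Tome I*, Exp. VII_A (P. Gabriel) §4, 4.1–4.3.
* [AtiyahMacdonald1969] M. F. Atiyah, I. G. Macdonald, *Introduction to Commutative Algebra* (1969) — Ch. 8, Prop. 8.8 and Example.
* [Tate1997FiniteFlatGroupSchemes] J. Tate, *Finite flat group schemes*, in: Modular Forms and Fermat's Last Theorem (1997) — (3.7).
* [MumfordAV1970] D. Mumford, *Abelian Varieties* (1970) — §15 (p. 146) (`[p] = V ∘ F`).
* [GortzWedhorn2020] U. Görtz, T. Wedhorn, *Algebraic Geometry I* (2nd ed. 2020) — (6.4) Definition 6.2, Proposition 6.7; Definition 4.45 (2) (p. 117).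
* [Liu2021] Y. Liu, *Fourier–Jacobi cycles and arithmetic relative trace formula*, Camb. J. Math. 9 (2021) — p. 137.
-/

set_option autoImplicit false

noncomputable section

-- Mathlib's `Over`/`Scheme` and the transported group structures are stated across semireducible wrappers (as in ★ `GroupSchemes/*`).
set_option backward.isDefEq.respectTransparency false

-- As in ★ (FKw): statements of the shape `c ≫ F^t = 1` need the slow `One (T ⟶ G^{(p^t)})` instance search (Mathlib's scoped `Hom.monoid`
-- through the transported structure of the twist); no proof `maxHeartbeats` budget is raised.
set_option synthInstance.maxHeartbeats 200000

open CategoryTheory CategoryTheory.Limits AlgebraicGeometry MonoidalCategory CartesianMonoidalCategory Polynomial IsLocalRing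

open scoped MonObj Obj

universe u

namespace Literature.AlgebraicGeometry.GroupSchemes

open Literature.AlgebraicGeometry.Motives GroupSchemeKernel AffineGroupScheme

/-! ## §1 The ideal of `Ker F^t ↪ G` lies in the square of the augmentation ideal; unit cotangent spaces -/

section FrobeniusIdeal

variable {k : Type u} [Field k] (p : ℕ) [ExpChar k p] (t : ℕ) {G : SchemeOver k} [GrpObj G]

/-- **The ideal of `Ker F^t_{G∕k} ↪ G` lies in the span of the `p^t`-th powers of the augmentation ideal** `I_e = ker Γ(η_G)`, for every
`k`-group scheme `G` with affine underlying scheme: Mathlib's ideal-sheaf subscheme `V(J) ↪ G`, `J := ({m^{p^t} : m ∈ I_e})`, is killed by `F^t`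
— by the criterion ★ `comp_relFrobeniusOver_eq_one_iff_unit` checked on global sections, since `a = π a + m` with `m ∈ I_e` (★ `sub_appTop_appTop_mem_ker`)
gives `a^{p^t} − (π a)^{p^t} = m^{p^t} ∈ J` (★ `add_pow_expChar_pow_sections`) — hence factors through the kernel (★ `kerLift`), so every function
vanishing on `Ker F^t` vanishes on `V(J)`.  (The «⊆» half of ★ (FKw) `ker_appTop_kerι_relFrobeniusOver_eq_span`, with no principal generator.)
[cite: SGA3I, VII_A 4.1–4.3] [cite: Demazure1972, Ch. II §7] [cite: GortzWedhorn2020, Definition 4.45 (2) (p. 117)] -/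
theorem ker_appTop_kerι_relFrobeniusOver_le_span_image_pow [IsAffine G.left] :
    RingHom.ker (kerι (relFrobeniusOver p t G)).left.appTop.hom ≤
      Ideal.span ((fun m => m ^ p ^ t) '' (RingHom.ker (η[G] : 𝟙_ (SchemeOver k) ⟶ G).left.appTop.hom : Set Γ(G.left, ⊤))) := by
  set J : Ideal Γ(G.left, ⊤) :=
    Ideal.span ((fun m => m ^ p ^ t) '' (RingHom.ker (η[G] : 𝟙_ (SchemeOver k) ⟶ G).left.appTop.hom : Set Γ(G.left, ⊤))) with hJ
  set j := (Scheme.IdealSheafData.ofIdealTop J).subschemeι with hj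
  have hkerj : RingHom.ker j.appTop.hom = J := by
    have h : (Scheme.IdealSheafData.equivOfIsAffine (X := G.left)).symm J =
        (Scheme.IdealSheafData.equivOfIsAffine (X := G.left)).symm (RingHom.ker j.appTop.hom) := by
      simp only [Scheme.IdealSheafData.equivOfIsAffine_symm_apply]
      rw [← Scheme.ker_of_isAffine j, hj, Scheme.IdealSheafData.ker_subschemeι]
    exact ((Scheme.IdealSheafData.equivOfIsAffine (X := G.left)).symm.injective h).symm
  let Z : SchemeOver k := Over.mk (j ≫ G.hom)
  let c : Z ⟶ G := Over.homMk j rfl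
  -- `V(J)` is killed by `F^t`: check the unit-section criterion on global sections of the affine `G`
  have hc := (comp_relFrobeniusOver_eq_one_iff_unit p t c).2 <| by
    rw [← Over.w c, Category.assoc]
    refine ext_of_isAffine ?_
    ext a
    rw [Scheme.Hom.comp_appTop, Scheme.Hom.comp_appTop, Scheme.Hom.comp_appTop, Scheme.Hom.comp_appTop]
    change (absFrobeniusOver p t Z).appTop (c.left.appTop a) =
      c.left.appTop (G.hom.appTop ((frobSpec k p t).appTop ((η[G] : 𝟙_ (SchemeOver k) ⟶ G).left.appTop a)))
    have hfrob : (frobSpec k p t).appTop ((η[G] : 𝟙_ (SchemeOver k) ⟶ G).left.appTop a) =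
        ((η[G] : 𝟙_ (SchemeOver k) ⟶ G).left.appTop a) ^ p ^ t := by
      rw [← absFrobeniusOver_tensorUnit p t]
      exact powEndo_appTop_apply _ _ _ _ _
    rw [powEndo_appTop_apply, hfrob, map_pow, ← map_pow, ← sub_eq_zero, ← map_sub]
    -- `a = π a + m`, `m ∈ I_e`, so `a^{p^t} - (π a)^{p^t} = m^{p^t} ∈ J ⊆ ker Γ(c)`
    have hmem := sub_appTop_appTop_mem_ker G η[G] a
    set m := a - G.hom.appTop ((η[G] : 𝟙_ (SchemeOver k) ⟶ G).left.appTop a) with hm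
    have ha : a = G.hom.appTop ((η[G] : 𝟙_ (SchemeOver k) ⟶ G).left.appTop a) + m := by rw [hm, add_sub_cancel]
    have hadd := add_pow_expChar_pow_sections p t G ⊤ (G.hom.appTop ((η[G] : 𝟙_ (SchemeOver k) ⟶ G).left.appTop a)) m
    rw [← ha] at hadd
    rw [hadd, add_sub_cancel_left]
    have hmJ : m ^ p ^ t ∈ J := Ideal.subset_span ⟨m, hmem, rfl⟩
    have hle : J ≤ RingHom.ker c.left.appTop.hom := by
      change J ≤ RingHom.ker j.appTop.hom
      rw [hkerj]
    exact hle hmJ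
  have hfac := kerLift_ι c hc
  intro a ha
  have ha' : j.appTop.hom a = 0 := by
    have h : (kerLift c hc ≫ kerι (relFrobeniusOver p t G)).left.appTop.hom a = c.left.appTop.hom a := by rw [hfac]
    rw [Over.comp_left, Scheme.Hom.comp_appTop] at h
    change (kerLift c hc).left.appTop.hom ((kerι (relFrobeniusOver p t G)).left.appTop.hom a) = j.appTop.hom a at h
    rw [← h, RingHom.mem_ker.mp ha, map_zero]
  have : a ∈ RingHom.ker j.appTop.hom := ha'
  rwa [hkerj] at this

/-- **… hence in the SQUARE of the augmentation ideal when `p^t ≥ 2`** (`m^{p^t} ∈ I_e^{p^t} ⊆ I_e²`).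
[cite: SGA3I, VII_A 4.1–4.3] [cite: Demazure1972, Ch. II §7] -/
theorem ker_appTop_kerι_relFrobeniusOver_le_sq [IsAffine G.left] (h2 : 2 ≤ p ^ t) :
    RingHom.ker (kerι (relFrobeniusOver p t G)).left.appTop.hom ≤
      (RingHom.ker (η[G] : 𝟙_ (SchemeOver k) ⟶ G).left.appTop.hom : Ideal Γ(G.left, ⊤)) ^ 2 := by
  refine (ker_appTop_kerι_relFrobeniusOver_le_span_image_pow p t).trans ?_
  rw [Ideal.span_le]
  rintro _ ⟨m, hm, rfl⟩
  exact Ideal.pow_le_pow_right h2 (Ideal.pow_mem_pow hm _)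


/-! ### §1b Unit cotangent spaces: along `Ker F^t ↪ G` (bijection) and along a homomorphic closed immersion (surjection) -/

/-- The unit-cotangent map of a homomorphism `φ : X → Y` whose `Γ(φ)` is SURJECTIVE (e.g. a closed immersion into an affine `Y`) is surjective
(`I_X = Γ(φ)(I_Y)` since `I_Y = Γ(φ)⁻¹ I_X`, ★ `comap_ker_unit_eq`). [cite: GortzWedhorn2020, (6.4) Definition 6.2 and Proposition 6.7] -/
theorem mapCotangent_unit_surjective_of_surjective {X Y : SchemeOver k} [GrpObj X] [GrpObj Y] (φ : X ⟶ Y) [IsMonHom φ]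
    (hφ : Function.Surjective (Alg.comap φ)) :
    Function.Surjective (Ideal.mapCotangent _ _ (Alg.comap φ) (ker_unit_le_comap φ)) := by
  intro y
  obtain ⟨⟨b, hb⟩, rfl⟩ := Ideal.toCotangent_surjective _ y
  obtain ⟨a, rfl⟩ := hφ b
  have ha : a ∈ (RingHom.ker ((η[Y] : 𝟙_ (Over (Spec (.of k))) ⟶ Y).left.appTop.hom) : Ideal (Alg Y)) := by
    rw [← comap_ker_unit_eq φ, Ideal.mem_comap]
    exact hb
  exact ⟨Ideal.toCotangent _ ⟨a, ha⟩, by rw [Ideal.mapCotangent_toCotangent]⟩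

/-- The unit cotangent space `I_e ∕ I_e²` of a FINITE `k`-group scheme is a finite-dimensional `k`-space (★ `TangentHom.finite_cotangent` for
the augmentation ★ `exists_augmentation_ker_eq`; `Γ(Y)` is a finite `k`-algebra). [cite: GortzWedhorn2020, (6.4) Definition 6.2] -/
theorem finite_cotangent_unit (Y : SchemeOver k) [GrpObj Y] [IsFinite Y.hom] :
    Module.Finite k (RingHom.ker ((η[Y] : 𝟙_ (Over (Spec (.of k))) ⟶ Y).left.appTop.hom) : Ideal (Alg Y)).Cotangent := by
  haveI : Module.Finite k (Alg Y) := Alg.moduleFinite Y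
  haveI : IsArtinianRing (Alg Y) := IsArtinianRing.of_finite k _
  obtain ⟨ε, hε⟩ := exists_augmentation_ker_eq Y
  rw [← hε]
  exact Literature.RingTheory.CompleteLocalRings.TangentHom.finite_cotangent (π := ε)

/-- **A homomorphic CLOSED IMMERSION `φ : X ↪ Y` into a finite `k`-group scheme does not increase the unit cotangent rank**:
`dim_k cot(X) ≤ dim_k cot(Y)` (the cotangent map of `φ` is surjective). [cite: GortzWedhorn2020, (6.4) Definition 6.2 and Proposition 6.7] -/
theorem finrank_cotangent_unit_le_of_isClosedImmersion {X Y : SchemeOver k} [GrpObj X] [GrpObj Y] (φ : X ⟶ Y) [IsMonHom φ]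
    [IsFinite Y.hom] [IsClosedImmersion φ.left] :
    Module.finrank k (RingHom.ker ((η[X] : 𝟙_ (Over (Spec (.of k))) ⟶ X).left.appTop.hom) : Ideal (Alg X)).Cotangent ≤
      Module.finrank k (RingHom.ker ((η[Y] : 𝟙_ (Over (Spec (.of k))) ⟶ Y).left.appTop.hom) : Ideal (Alg Y)).Cotangent := by
  haveI : IsAffine Y.left := isAffine_of_isAffineHom Y.hom
  haveI := finite_cotangent_unit Y
  have hφ : Function.Surjective (Alg.comap φ) := (IsClosedImmersion.isAffine_surjective_of_isAffine φ.left).2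
  have hs := mapCotangent_unit_surjective_of_surjective φ hφ
  rw [← LinearMap.range_eq_top] at hs
  rw [← finrank_top k, ← hs]
  exact LinearMap.finrank_range_le _

/-- **`dim_k cot(G) = dim_k cot(Ker F^t_{G∕k})`** for a finite `k`-group scheme `G` and `p^t ≥ 2`: `Γ(G) ↠ Γ(Ker F^t)` has kernel inside `I_e²`
(`ker_appTop_kerι_relFrobeniusOver_le_sq`), so it induces a bijection `I_e∕I_e² ⥲ I'_e∕I'_e²` (★ `Ideal.mapCotangent_bijective_of_surjective_of_ker_le_sq`).
The Frobenius kernel has the same Zariski tangent space as the group. [cite: Demazure1972, Ch. II §7] [cite: SGA3I, VII_A 4.1–4.3]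
[cite: GortzWedhorn2020, (6.4) Definition 6.2] -/
theorem finrank_cotangent_unit_eq_finrank_cotangent_unit_ker_relFrobeniusOver [IsFinite G.hom] (h2 : 2 ≤ p ^ t) :
    haveI := isMonHom_relFrobeniusOver p t G
    Module.finrank k (RingHom.ker ((η[G] : 𝟙_ (Over (Spec (.of k))) ⟶ G).left.appTop.hom) : Ideal (Alg G)).Cotangent =
      Module.finrank k (RingHom.ker ((η[ker (relFrobeniusOver p t G)] : 𝟙_ (Over (Spec (.of k))) ⟶ _).left.appTop.hom) :
        Ideal (Alg (ker (relFrobeniusOver p t G)))).Cotangent := by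
  haveI : IsAffine G.left := isAffine_of_isAffineHom G.hom
  haveI := isMonHom_relFrobeniusOver p t G
  haveI := isClosedImmersion_kerι_relFrobeniusOver_left p t (G := G)
  have hφ : Function.Surjective (Alg.comap (kerι (relFrobeniusOver p t G))) :=
    (IsClosedImmersion.isAffine_surjective_of_isAffine (kerι (relFrobeniusOver p t G)).left).2
  have hK : RingHom.ker (Alg.comap (kerι (relFrobeniusOver p t G))).toRingHom ≤
      (RingHom.ker ((η[G] : 𝟙_ (Over (Spec (.of k))) ⟶ G).left.appTop.hom) : Ideal (Alg G)) ^ 2 :=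
    ker_appTop_kerι_relFrobeniusOver_le_sq p t h2
  exact (LinearEquiv.ofBijective _ (Ideal.mapCotangent_bijective_of_surjective_of_ker_le_sq _ hφ _ _
    (comap_ker_unit_eq (kerι (relFrobeniusOver p t G))) hK)).finrank_eq

end FrobeniusIdeal

/-! ## §2 A monogenic `k`-group has unit cotangent rank `≤ 1` -/

section Monogenic

variable {k : Type u} [Field k] {N : ℕ}

/-- **`dim_k cot(U₀) ≤ 1` for a MONOGENIC `k`-group scheme `Γ(U₀) ≃ₐ[k] k[X]⧸(X^N)`** (`N ≠ 0`): `Γ(U₀)` is local with principal maximal ideal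
(★ `maximalIdeal_eq_span_of_algEquiv_quotient_X_pow`), so `dim 𝔪∕𝔪² ≤ 1` (Mathlib `finrank_cotangentSpace_le_one_iff`), and `𝔪∕𝔪²` is the unit cotangent
space (★ `finrank_residueField_cotangentSpace_eq_finrank_ker_cotangent` for the augmentation ★ `exists_augmentation_ker_eq`).
[cite: AtiyahMacdonald1969, Ch. 8, Prop. 8.8 and Example] [cite: Tate1997FiniteFlatGroupSchemes, (3.7)] -/
theorem finrank_cotangent_unit_le_one_of_algEquiv (U₀ : SchemeOver k) [GrpObj U₀]
    (ψ : Alg U₀ ≃ₐ[k] (k[X] ⧸ Ideal.span {(X : k[X]) ^ N})) (hN : N ≠ 0) :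
    Module.finrank k (RingHom.ker ((η[U₀] : 𝟙_ (Over (Spec (.of k))) ⟶ U₀).left.appTop.hom) : Ideal (Alg U₀)).Cotangent ≤ 1 := by
  haveI := isLocalRing_of_algEquiv_quotient_X_pow ψ hN
  haveI := isArtinianRing_of_algEquiv_quotient_X_pow ψ hN
  obtain ⟨ε, hε⟩ := exists_augmentation_ker_eq U₀
  have hε' : RingHom.ker ε = (RingHom.ker ((η[U₀] : 𝟙_ (Over (Spec (.of k))) ⟶ U₀).left.appTop.hom) : Ideal (Alg U₀)) := hε
  rw [← hε', ← Literature.AlgebraicGeometry.Morphisms.finrank_residueField_cotangentSpace_eq_finrank_ker_cotangent ε]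
  exact (finrank_cotangentSpace_le_one_iff (R := Alg U₀)).mpr ⟨⟨_, maximalIdeal_eq_span_of_algEquiv_quotient_X_pow ψ⟩⟩

/-- **In a finite `k`-group `U` whose unit cotangent space has dimension `≤ 1` (connected, flat — so `Γ(U) ≃ₐ k[X]⧸(X^M)`, ★ PRODUCER
`exists_algEquiv_quotient_X_pow_of_connectedSpace`), the Frobenius kernel `Ker F^f_{U∕k}` lies in every closed subscheme `u₀ : U₀ ↪ U` that is
monogenic of exponent `p^N`, `f ≤ N`**: closed subschemes of `U` are nested by rank (★ `exists_fac_of_finrank_alg_le`) and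
`rank Ker F^f_U = min(p^f, M) ≤ p^f ≤ p^N = rank U₀` (★ `finrank_alg_ker_relFrobeniusOver`). [cite: Tate1967, §2.2 (proof of Prop. 1)]
[cite: Demazure1972, Ch. II §7] [cite: AtiyahMacdonald1969, Ch. 8, Prop. 8.8 and Example] -/
theorem exists_kerι_relFrobeniusOver_fac_of_finrank_cotangent_unit_le_one (p : ℕ) [ExpChar k p] (hp : 0 < p) (f : ℕ)
    (U : SchemeOver k) [GrpObj U] [IsFinite U.hom] [Flat U.hom] (hU : ConnectedSpace ↥U.left)
    (htan : Module.finrank k (RingHom.ker ((η[U] : 𝟙_ (Over (Spec (.of k))) ⟶ U).left.appTop.hom) : Ideal (Alg U)).Cotangent ≤ 1)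
    {U₀ : SchemeOver k} (u₀ : U₀ ⟶ U) [IsClosedImmersion u₀.left]
    (ψ₀ : Alg U₀ ≃ₐ[k] (k[X] ⧸ Ideal.span {(X : k[X]) ^ (p ^ N)})) (hf : f ≤ N) :
    ∃ φ : ker (relFrobeniusOver p f U) ⟶ U₀, φ ≫ u₀ = kerι (relFrobeniusOver p f U) := by
  haveI : IsAffine U.left := isAffine_of_isAffineHom U.hom
  -- `U` is MONOGENIC: `Γ(U) ≃ₐ k[X]⧸(X^M)`, `M = rank U ≠ 0`
  obtain ⟨ε, hε⟩ := exists_augmentation_ker_eq U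
  have htan' : Module.finrank k (RingHom.ker ε.toRingHom).Cotangent ≤ 1 := by rw [hε]; exact htan
  let pt : Spec (.of k) := (⊥ : PrimeSpectrum k)
  obtain ⟨ψ⟩ := exists_algEquiv_quotient_X_pow_of_connectedSpace U hU ε htan' pt
  have hM0 : U.hom.finrank pt ≠ 0 := by
    rw [← finrank_alg_eq_finrank_hom U pt]
    haveI : Module.Finite k (Alg U) := Alg.moduleFinite U
    haveI : Nontrivial (Alg U) := ε.toRingHom.domain_nontrivial
    exact Module.finrank_pos.ne'
  haveI : IsLocalRing (Alg U) := isLocalRing_of_algEquiv_quotient_X_pow ψ hM0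
  -- nested by rank
  haveI := isClosedImmersion_kerι_relFrobeniusOver_left p f (G := U)
  have hrk : Module.finrank k (Alg (ker (relFrobeniusOver p f U))) ≤ Module.finrank k (Alg U₀) := by
    rw [finrank_alg_ker_relFrobeniusOver p f ψ hM0, finrank_eq_of_algEquiv_quotient_X_pow ψ₀]
    exact (min_le_left _ _).trans (Nat.pow_le_pow_right hp hf)
  exact exists_fac_of_finrank_alg_le ⟨⟨_, maximalIdeal_eq_span_of_algEquiv_quotient_X_pow ψ⟩⟩
    (kerι (relFrobeniusOver p f U)) u₀ hrk

end Monogenic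

end Literature.AlgebraicGeometry.GroupSchemes

/-! ## §3 The head: `A[F_q] ∩ A[𝔭^n] ⊆ A[𝔭]` in `A`-currency -/

namespace Literature.AlgebraicGeometry.AbelianSchemes.AbelianSchemeOver

open Literature.AlgebraicGeometry.Motives Literature.AlgebraicGeometry.GroupSchemes
open Literature.AlgebraicGeometry.GroupSchemes.GroupSchemeKernel Literature.AlgebraicGeometry.GroupSchemes.AffineGroupScheme

/-- `w ≤ w² + J ⇒ w ≤ wⁿ + J` for every `n ≥ 1` (`w² ≤ w(wⁿ + J) ≤ wⁿ⁺¹ + J`).  With `J = (p)`: an UNRAMIFIED prime `𝔭 ∋ p` of a Dedekind ring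
(`𝔭² ∤ (p)`, so `𝔭 = 𝔭² + (p)`) satisfies `𝔭 ≤ 𝔭ⁿ + (p)` — a `𝔭ⁿ`-torsion point killed by `p` is killed by `𝔭`. [cite: Neukirch1999, Ch. I §3 (3.6)] -/
theorem le_pow_sup_of_le_sq_sup {O : Type*} [CommSemiring O] {w J : Ideal O} (h : w ≤ w ^ 2 ⊔ J) {n : ℕ} (hn : 1 ≤ n) :
    w ≤ w ^ n ⊔ J := by
  induction n, hn using Nat.le_induction with
  | base => rw [pow_one]; exact le_sup_left
  | succ m hm ih =>
    refine h.trans (sup_le ?_ le_sup_right)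
    calc w ^ 2 = w * w := sq w
      _ ≤ w * (w ^ m ⊔ J) := Ideal.mul_mono_right ih
      _ = w ^ (m + 1) ⊔ w * J := by rw [Ideal.mul_sup, pow_succ']
      _ ≤ w ^ (m + 1) ⊔ J := sup_le_sup_left Ideal.mul_le_left _

section Head

variable {k : Type u} [Field k] [PerfectField k] (p : ℕ) [Fact p.Prime] [CharP k p] [ExpChar k p] (f : ℕ)
  (A : AbelianSchemeOver (Spec (.of k))) {O : Type*} [CommRing O] (act : RingAction O A) (w : Ideal O)

omit [PerfectField k] [Fact p.Prime] [CharP k p] in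
/-- The trivial `T`-point of the Frobenius twist in the two currencies of the tree — ★ `frobeniusTwistOver p f A.X` (group structure transported
along `Over.pullback (Spec Frob^f)`, `open scoped Obj`) and the spine's `(A.baseChange (frobSpec k p f)).X` (★ `AbelianSchemeOver.baseChange`, the SAME
transported structure behind a `def`) — agree (`rfl`; isolated here so that consumers REWRITE instead of unfolding `baseChange` inside a large goal).
[cite: GortzWedhorn2020, Section (4.7)] -/
theorem one_hom_frobeniusTwistOver_eq (T : SchemeOver k) :
    (1 : T ⟶ frobeniusTwistOver p f A.X) = (1 : T ⟶ (A.baseChange (frobSpec k p f)).X) := rfl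

/-- **`Ker F_p|_{A[wⁿ]}` is a homomorphic closed subscheme of the unit component of `A[w]`, hence `dim cot(Ker F_p|_{A[wⁿ]}) ≤ dim cot(A[w]⁰)`**
— for `w ≤ wⁿ + (p)` (`w` unramified, `n ≥ 1`): the Frobenius kernel `Ker F_p|_H ↪ A` of `H = A[wⁿ]` is killed by `p` (`[p] = V ∘ F`, ★
`comp_mulN_eq_one_of_comp_relFrobeniusOver_eq_one`) and by `wⁿ`, so by `w`, so it factors through `G₀ = A[w]` (`hkerG₀`) by a homomorphism and — having
one point (★ `connectedSpace_ker_relFrobeniusOver_left`) — through the unit component `U₀` (★ `existsUnique_fac_hom`) by a homomorphic CLOSED IMMERSION;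
§1 `finrank_cotangent_unit_le_of_isClosedImmersion`. [cite: MumfordAV1970, §15 (p. 146)] [cite: Tate1997FiniteFlatGroupSchemes, (3.7)]
[cite: GortzWedhorn2020, (6.4) Proposition 6.7] -/
theorem finrank_cotangent_unit_ker_relFrobeniusOver_le_of_pow_torsion {n : ℕ} (hwn : w ≤ w ^ n ⊔ Ideal.span {(p : O)})
    (G₀ : SchemeOver k) [GrpObj G₀] [IsFinite G₀.hom] (ι₀G : G₀ ⟶ A.X) (hι₀G : IsMonHom ι₀G ∧ IsClosedImmersion ι₀G.left)
    (hkerG₀ : ∀ ⦃T : SchemeOver k⦄ (t : T ⟶ A.X), (∀ r ∈ w, t ≫ act.i r = 1) ↔ ∃ s : T ⟶ G₀, s ≫ ι₀G = t)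
    (U₀ : SchemeOver k) [GrpObj U₀] (jU₀ : U₀ ⟶ G₀)
    (hU₀ : IsMonHom jU₀ ∧ IsOpenImmersion jU₀.left ∧ IsClosedImmersion jU₀.left ∧ ConnectedSpace ↥U₀.left)
    (H : SchemeOver k) [GrpObj H] [IsFinite H.hom] (ιH : H ⟶ A.X) (hιH : IsMonHom ιH ∧ IsClosedImmersion ιH.left)
    (hkerH : ∀ ⦃T : SchemeOver k⦄ (t : T ⟶ A.X), (∀ r ∈ w ^ n, t ≫ act.i r = 1) ↔ ∃ s : T ⟶ H, s ≫ ιH = t) :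
    haveI := isMonHom_relFrobeniusOver p 1 H
    Module.finrank k (RingHom.ker ((η[ker (relFrobeniusOver p 1 H)] : 𝟙_ (Over (Spec (.of k))) ⟶ _).left.appTop.hom) :
        Ideal (Alg (ker (relFrobeniusOver p 1 H)))).Cotangent ≤
      Module.finrank k (RingHom.ker ((η[U₀] : 𝟙_ (Over (Spec (.of k))) ⟶ U₀).left.appTop.hom) : Ideal (Alg U₀)).Cotangent := by
  obtain ⟨hι₀Gm, hι₀Gc⟩ := hι₀G
  obtain ⟨hιHm, hιHc⟩ := hιH
  obtain ⟨hjU₀m, hjU₀o, hjU₀c, hU₀conn⟩ := hU₀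
  haveI := isMonHom_relFrobeniusOver p 1 H
  haveI : IsAffine H.left := isAffine_of_isAffineHom H.hom
  haveI : IsSeparated H.hom := inferInstance
  haveI : Mono ιH.left := ((IsClosedImmersion.iff_isFinite_and_mono ιH.left).mp inferInstance).2
  haveI : Mono ι₀G.left := ((IsClosedImmersion.iff_isFinite_and_mono ι₀G.left).mp inferInstance).2
  haveI : Mono ι₀G := Over.mono_of_mono_left ι₀G
  haveI : Mono jU₀.left := ((IsClosedImmersion.iff_isFinite_and_mono jU₀.left).mp inferInstance).2
  haveI : Mono jU₀ := Over.mono_of_mono_left jU₀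
  haveI : Nonempty ↥(𝟙_ (SchemeOver k)).left := ⟨(IsLocalRing.closedPoint k : ↥(Spec (.of k)))⟩
  haveI : IsFinite U₀.hom := isFinite_hom_of_unitComponent jU₀
  -- `Ker F_p|_H ↪ A` is killed by `p` (`[p] = V ∘ F`) and by `wⁿ`, hence by `w ≤ wⁿ + (p)`
  have hc₁F := kerι_comp_comp_relFrobeniusOver_eq_one p 1 ιH (G := A.X)
  rw [one_hom_frobeniusTwistOver_eq p 1 A] at hc₁F
  have hc₁p : (kerι (relFrobeniusOver p 1 H) ≫ ιH) ≫ A.mulN (p ^ 1) = 1 :=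
    comp_mulN_eq_one_of_comp_relFrobeniusOver_eq_one p 1 A _ hc₁F
  have hc₁w : ∀ b ∈ w, (kerι (relFrobeniusOver p 1 H) ≫ ιH) ≫ act.i b = 1 := by
    intro b hb
    refine (act.forall_mem_sup_iff (kerι (relFrobeniusOver p 1 H) ≫ ιH)).2 ⟨?_, fun d hd => ?_⟩ b (hwn hb)
    · exact (hkerH _).2 ⟨kerι (relFrobeniusOver p 1 H), rfl⟩
    · refine act.comp_i_eq_one_of_mem_span_of_comp_mulN _ hc₁p ?_
      rwa [_root_.pow_one]
  -- … so it factors through `G₀`, by a homomorphism, and through the unit component `U₀`, by a homomorphic closed immersion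
  obtain ⟨g₁, hg₁⟩ := (hkerG₀ _).1 hc₁w
  haveI : IsMonHom (g₁ ≫ ι₀G) := by rw [hg₁]; infer_instance
  haveI : IsMonHom g₁ := isMonHom_of_comp ι₀G g₁
  haveI : ConnectedSpace ↥(ker (relFrobeniusOver p 1 H)).left := connectedSpace_ker_relFrobeniusOver_left p 1 H
  obtain ⟨g₀, hg₀, -⟩ := existsUnique_fac_hom jU₀ g₁
  haveI : IsMonHom (g₀ ≫ jU₀) := by rw [hg₀]; infer_instance
  haveI : IsMonHom g₀ := isMonHom_of_comp jU₀ g₀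
  haveI := isClosedImmersion_kerι_relFrobeniusOver_left p 1 (G := H)
  haveI : IsClosedImmersion (jU₀.left ≫ ι₀G.left) := inferInstance
  haveI : IsClosedImmersion (g₀.left ≫ jU₀.left ≫ ι₀G.left) := by
    rw [← Category.assoc, ← Over.comp_left, ← Over.comp_left, hg₀, hg₁, Over.comp_left]; infer_instance
  haveI : IsClosedImmersion g₀.left := IsClosedImmersion.of_comp g₀.left (jU₀.left ≫ ι₀G.left)
  exact finrank_cotangent_unit_le_of_isClosedImmersion g₀

/-- **THE HEAD — «`A[F_q] ∩ A[𝔭ⁿ] ⊆ A[𝔭]`»: FROBENIUS SATURATION OF AN UNRAMIFIED ONE-DIMENSIONAL BLOCK, READ OFF THE DOCK.**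
`k` a perfect field of characteristic `p`, `A∕k` an abelian scheme with a ring action `ι` of `O`, `w ⊆ O` an ideal with `w ≤ w² + (p)`
(«`w` is unramified over `p`»); `ι₀G : G₀ ↪ A` a homomorphic closed immersion representing the `w`-torsion (`hkerG₀`, the dock clause), `jU₀ : U₀ ↪ G₀` a
unit component (homomorphism, open-and-closed immersion, connected) with `Γ(U₀) ≃ₐ k[X]⧸(X^{p^{N}})`, `f ≤ N` (the dock rows `hU₀`, `θU₀`, `hNU₀`); `ιH : H ↪ A`
a finite flat homomorphic closed subgroup representing the `wⁿ`-torsion (`hkerH`; e.g. ★ `IdealTorsion` `ker (serreTranslate …)`).  THEN every `T`-valued point `x`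
of `A` killed by `wⁿ` and by the relative `p^f`-Frobenius `F_{A∕k}` is killed by `w`.  Proof = the module docstring §3: `cot(H⁰) = cot(H) =
cot(Ker F_p|_H) ≤ cot(U₀) ≤ 1`, so `H⁰` is monogenic, its closed subschemes are nested by rank, and `Ker F_f|_{H⁰}` (rank `≤ p^f`) lies in `U₀` (rank
`p^N`) `⊆ G₀`.  [cite: Liu2021, p. 137] [cite: Tate1967, §2.2 (proof of Prop. 1)] [cite: Demazure1972, Ch. II §7] [cite: Tate1997FiniteFlatGroupSchemes, (3.7)]
[cite: MumfordAV1970, §15 (p. 146)] [cite: AtiyahMacdonald1969, Ch. 8, Prop. 8.8 and Example] -/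
theorem forall_comp_i_eq_one_of_pow_torsion_of_comp_relFrobeniusOver_eq_one
    (hunr : w ≤ w ^ 2 ⊔ Ideal.span {(p : O)})
    (G₀ : SchemeOver k) [GrpObj G₀] [IsFinite G₀.hom] (ι₀G : G₀ ⟶ A.X) (hι₀G : IsMonHom ι₀G ∧ IsClosedImmersion ι₀G.left)
    (hkerG₀ : ∀ ⦃T : SchemeOver k⦄ (t : T ⟶ A.X), (∀ r ∈ w, t ≫ act.i r = 1) ↔ ∃ s : T ⟶ G₀, s ≫ ι₀G = t)
    (U₀ : SchemeOver k) [GrpObj U₀] (jU₀ : U₀ ⟶ G₀)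
    (hU₀ : IsMonHom jU₀ ∧ IsOpenImmersion jU₀.left ∧ IsClosedImmersion jU₀.left ∧ ConnectedSpace ↥U₀.left)
    {N : ℕ} (θU₀ : (k[X] ⧸ Ideal.span {(Polynomial.X : k[X]) ^ (p ^ N)}) ≃ₐ[k] Alg U₀) (hf : f ≤ N)
    {n : ℕ} (H : SchemeOver k) [GrpObj H] [IsFinite H.hom] [Flat H.hom] (ιH : H ⟶ A.X) (hιH : IsMonHom ιH ∧ IsClosedImmersion ιH.left)
    (hkerH : ∀ ⦃T : SchemeOver k⦄ (t : T ⟶ A.X), (∀ r ∈ w ^ n, t ≫ act.i r = 1) ↔ ∃ s : T ⟶ H, s ≫ ιH = t)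
    ⦃T : SchemeOver k⦄ (x : T ⟶ A.X) (hx : ∀ b ∈ w ^ n, x ≫ act.i b = 1)
    (hFx : x ≫ relFrobeniusOver p f A.X = (1 : T ⟶ (A.baseChange (frobSpec k p f)).X)) :
    ∀ b ∈ w, x ≫ act.i b = 1 := by
  have hp : p.Prime := Fact.out
  -- `n = 0`: `x` is killed by `O`, so `x = 1`
  rcases Nat.eq_zero_or_pos n with rfl | hn
  · rw [_root_.pow_zero, Ideal.one_eq_top] at hx
    have hx1 : x = 1 := (act.forall_mem_top_iff x).1 hx
    intro b _
    haveI := act.isMonHom_i b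
    rw [hx1]
    exact MonObj.one_comp _
  have hcot := finrank_cotangent_unit_ker_relFrobeniusOver_le_of_pow_torsion p A act w (le_pow_sup_of_le_sq_sup hunr hn)
    G₀ ι₀G hι₀G hkerG₀ U₀ jU₀ hU₀ H ιH hιH hkerH
  obtain ⟨hι₀Gm, hι₀Gc⟩ := hι₀G
  obtain ⟨hιHm, hιHc⟩ := hιH
  obtain ⟨hjU₀m, hjU₀o, hjU₀c, hU₀conn⟩ := hU₀
  haveI : IsAffine H.left := isAffine_of_isAffineHom H.hom
  haveI : IsSeparated H.hom := inferInstance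
  haveI : Mono ιH.left := ((IsClosedImmersion.iff_isFinite_and_mono ιH.left).mp inferInstance).2
  haveI : Mono ιH := Over.mono_of_mono_left ιH
  haveI : Nonempty ↥(𝟙_ (SchemeOver k)).left := ⟨(IsLocalRing.closedPoint k : ↥(Spec (.of k)))⟩
  -- S1: `x` is a point of `H = A[wⁿ]`
  obtain ⟨s, hs⟩ := (hkerH x).1 hx
  -- S2: `G₀ = A[w] ↪ H = A[wⁿ]` (`wⁿ ≤ w`)
  obtain ⟨i₀, hi₀⟩ := (hkerH ι₀G).1
    (fun r hr => ((hkerG₀ ι₀G).2 ⟨𝟙 _, Category.id_comp _⟩) r (Ideal.pow_le_self hn.ne' hr))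
  haveI : IsMonHom (i₀ ≫ ιH) := by rw [hi₀]; infer_instance
  haveI : IsMonHom i₀ := isMonHom_of_comp ιH i₀
  haveI : IsClosedImmersion (i₀.left ≫ ιH.left) := by rw [← Over.comp_left, hi₀]; infer_instance
  haveI : IsClosedImmersion i₀.left := IsClosedImmersion.of_comp i₀.left ιH.left
  -- S3: the unit component `U = H⁰`
  obtain ⟨U, instU, jU, hjUm, hjUo, hjUc, hUconn⟩ := exists_unitComponent k H
  haveI := hjUm
  haveI := hjUo
  haveI := hjUc
  haveI : IsAffineHom U.hom := by rw [← Over.w jU]; infer_instance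
  haveI : IsAffine U.left := isAffine_of_isAffineHom U.hom
  haveI : IsFinite U.hom := (isFinite_and_flat_of_immersions jU).1
  haveI : Flat U.hom := (isFinite_and_flat_of_immersions jU).2 inferInstance
  -- S4: `U₀ ↪ U` (a connected homomorphic subgroup lies in the unit component)
  obtain ⟨u₀, hu₀, -⟩ := existsUnique_fac_hom jU (jU₀ ≫ i₀)
  haveI : IsClosedImmersion (u₀.left ≫ jU.left) := by
    rw [← Over.comp_left, hu₀, Over.comp_left]; infer_instance
  haveI : IsClosedImmersion u₀.left := IsClosedImmersion.of_comp u₀.left jU.left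
  -- S5: `dim cot(U) = dim cot(H) = dim cot(Ker F_p|_H) ≤ dim cot(U₀) ≤ 1`
  have htan : Module.finrank k (RingHom.ker ((η[U] : 𝟙_ (Over (Spec (.of k))) ⟶ U).left.appTop.hom) : Ideal (Alg U)).Cotangent ≤ 1 := by
    rw [← finrank_cotangent_ker_unit_eq_of_unitComponent H U jU,
      finrank_cotangent_unit_eq_finrank_cotangent_unit_ker_relFrobeniusOver p 1 (G := H) (by rw [_root_.pow_one]; exact hp.two_le)]
    exact hcot.trans (finrank_cotangent_unit_le_one_of_algEquiv U₀ θU₀.symm (pow_ne_zero _ hp.ne_zero))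
  -- S6–S7: `U` is monogenic and `Ker F_f|_U ⊆ U₀` by rank
  obtain ⟨φ, hφ⟩ := exists_kerι_relFrobeniusOver_fac_of_finrank_cotangent_unit_le_one p hp.pos f U hUconn htan u₀ θU₀.symm hf
  -- S8: `x` lies in `Ker F_f|_H ≅ Ker F_f|_U ⊆ U₀ ⊆ G₀`
  haveI := isMonHom_relFrobeniusOver p f U
  haveI := isMonHom_relFrobeniusOver p f H
  rw [← one_hom_frobeniusTwistOver_eq p f A, ← hs] at hFx
  have hsF := (comp_relFrobeniusOver_eq_one_iff_unit p f s).2 ((comp_comp_relFrobeniusOver_eq_one_iff_unit p f ιH s).1 hFx)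
  obtain ⟨e, he⟩ := exists_iso_ker_relFrobeniusOver_unitComponent p f jU
  have hkerι : kerι (relFrobeniusOver p f H) = e.inv ≫ kerι (relFrobeniusOver p f U) ≫ jU := by
    rw [← he, Iso.inv_hom_id_assoc]
  refine (hkerG₀ x).2 ⟨kerLift s hsF ≫ e.inv ≫ φ ≫ jU₀, ?_⟩
  calc (kerLift s hsF ≫ e.inv ≫ φ ≫ jU₀) ≫ ι₀G
      = kerLift s hsF ≫ e.inv ≫ φ ≫ (jU₀ ≫ i₀) ≫ ιH := by rw [← hi₀]; simp only [Category.assoc]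
    _ = kerLift s hsF ≫ e.inv ≫ (φ ≫ u₀) ≫ jU ≫ ιH := by rw [← hu₀]; simp only [Category.assoc]
    _ = kerLift s hsF ≫ (e.inv ≫ kerι (relFrobeniusOver p f U) ≫ jU) ≫ ιH := by rw [hφ]; simp only [Category.assoc]
    _ = x := by rw [← hkerι, ← Category.assoc, kerLift_ι, hs]

end Head

end Literature.AlgebraicGeometry.AbelianSchemes.AbelianSchemeOver

end
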